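import Summits.ResolutionOfSingularities.ResolutionOfSingularities.Theorems.WildConesCampaignW46HypersurfacesCharTwoCubeCriterion

/-!
# [OURS · L1 W4.6, rung (ii) at p = 2, EVERY dimension n, EVERY field] NULL POLARS ARE NEAR: over every field
# of characteristic 2 a corank-two double point of `z² = a(u₁,…,uₙ)` with `h₂ ≥ 2` HAS a rational
# infinitely-near double point — the null-polar line `N`; at `(e, h₂) = (2, 2)` the point `N` is THE free near
# point whenever a free near point exists (the cube criterion without the satellite)

HONEST FRAMING. Everything here is OURS: theorems about route WildCones' own TYPED point-blow-up dynamics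
(`Theorems/WildConesClassicalRegimesDefs.lean`) and the seat's invariants `polarMatrix` (p502936),
`milnorEmbDim` (p498937), `milnorHilbertTwo` (p511581), `degForm` (p522667). NOTHING here is a statement of the
manuscript [Hironaka2017]; no FACT-LIST premise; AI review is weaker than expert review. Cell res-hironaka
(LADDER-RESOLUTION rung L, D-0089), slot W4.6, seat res-L1-s46-pv-4 (gen 7); host route `WildCones`, crux
`ClassicalRegimes` (stmt-ResolutionOfSingularities-16884; proved).

THE OBSERVATION. A NULL POLAR `λ` (a kernel vector of the polar form whose polar `v ↦ Σₛ λₛ (∂ₛa)₂(v)` vanishes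
on the kernel) lies ON the tangent cubic: by Euler in characteristic two, `a₃(λ) = polar(λ, λ) = 0` (p528427).
By the near-point criterion (p524988) `[λ]` is therefore an infinitely-near double point of the isolated double
point — a RATIONAL one, over the field of definition. The census of gen 6 read `h₂ = 1 + dim N` (p542945): so at
`h₂ ≥ 2` a near double point EXISTS over EVERY field of characteristic `2` (p538084 needed a perfect field to make
the satellite rational; p557052 an algebraically closed one). At `(e, h₂) = (2, 2)` the null polars form a line
`N = κλ₀` and `[λ₀]` is a CANONICAL near point: a free near vector `w` (some kernel polar non-zero at `w`) off the
line `κλ₀` is impossible — with `K = ⟨λ₀, w⟩`, every kernel polar at `w` is `α·polar(λ₀, w) + β·polar(w, w) =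
α·0 + β·a₃(w) = 0`. Hence THE FREE NEAR POINT, IF ANY, IS `N`; and `[λ₀]` fails to be free exactly when it is the
satellite (all kernel polars vanish at `λ₀`: the kernel cubic is the cube `ℓ₀³`, `N = S`, p549448's second case),
in which case it is the ONLY near point. This is the cube criterion of p549448 with the satellite `w₀` — which
over an imperfect field may be irrational (`x(x² + ty²) = x(x + √t·y)²`) — replaced by the always-rational null
polar.

WHAT IS PROVED (every `n`, EVERY field `κ` of characteristic `2`):

* `degForm_three_eq_zero_of_null_polar`, `hypersurface_null_polar_near`,
  `hypersurface_exists_double_successor_of_null_polar` — a null polar is on the cubic; for an isolated double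
  state (any corank) `[λ]` is a double successor;
* `hypersurface_exists_double_successor_of_two_le_milnorHilbertTwo` — **isolated, `e = 2`, `h₂ ≥ 2` ⇒ an
  infinitely-near double point EXISTS** (no hypothesis on the field);
* `hypersurface_free_near_propto_null_polar`, `hypersurface_free_successor_at_null_polar` — `e = 2`, `λ₀ ≠ 0` a
  null polar: every FREE near vector / every corank-`0` double successor sits at `[λ₀]`;
* `hypersurface_exists_free_iff_null_polar_not_satellite` — isolated `(2,2)`, `λ₀ ≠ 0` the null polar: **a free
  near double point exists ⟺ some kernel polar is non-zero at `λ₀`** (⟺ the kernel cubic is not a cube);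
* `hypersurface_null_polar_dichotomy` — isolated `(2,2)`: EITHER `[λ₀]` is free (corank-`0` successor: isolated,
  `μ = 1`, nothing after) and every other double successor is a satellite (corank `2`, isolated, `μ` drops), OR
  `[λ₀]` is the satellite and EVERY double successor sits at `[λ₀]` with corank `2`;
* `hypersurface_near_census_anyField_of_milnorHilbertTwo_eq_two` — the `(2,2)` census over every field: the
  near double points are `[λ₀]` and at most the satellite; in particular there is at least one and (p544683) at
  most two.

References: [CasasAlvero2000] §3 (free/satellite points: context only); [GreuelPfister2026] (context);
[Hironaka2017] Th. 16.6 p.84 — role replaced only, under adjudication; nothing of it is used.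
-/

noncomputable section

-- single-problem summit: the doubled namespace component `ResolutionOfSingularities` is forced
set_option linter.dupNamespace false

open scoped BigOperators Classical

open MvPowerSeries IsLocalRing

open Literature.AlgebraicGeometry.Resolution

namespace Summit.ResolutionOfSingularities.ResolutionOfSingularities.Theorems

namespace CampaignW46.HypersurfacesCharTwo

open WildCones WildCones.MuDropCharTwoOrdP ThreefoldsCharTwo

variable {κ : Type} [Field κ] {n : ℕ}

/-! ## A null polar lies on the tangent cubic -/

/-- [OURS · L1 W4.6] **A null polar is on the cubic** (characteristic two): if the polar of the kernel vector
`λ` vanishes at every kernel vector, then `a₃(λ) = polar(λ, λ) = 0` (Euler, p528427). Only the value at `λ`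
itself is used. [folklore] -/
theorem degForm_three_eq_zero_of_null_polar [CharP κ 2] (f : MvPowerSeries (Fin n) κ) {lam : Fin n → κ}
    (hlam : Matrix.vecMul lam (polarMatrix f) = 0)
    (hnull : ∀ v : Fin n → κ, Matrix.vecMul v (polarMatrix f) = 0 →
      ∑ s, lam s * degForm 2 (MvPowerSeries.pderiv s f) v = 0) :
    degForm 3 f lam = 0 := by
  rw [degForm_three_eq_polar_self]
  exact hnull lam hlam

/-- [OURS · L1 W4.6 rung (ii) at `p = 2`, every dimension, EVERY field; NOT a statement of the manuscript]
**A NULL POLAR IS AN INFINITELY-NEAR DOUBLE POINT.** For an isolated double state `c` of `z² = a(u₁,…,uₙ)`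
over any field of characteristic `2` (any corank) and a kernel vector `λ` with `λ_i ≠ 0` whose polar vanishes
on the kernel of the polar form, the point blow-up in chart `i` at the translation `λ/λ_i` has a DOUBLE point:
`[λ] ∈ ℙ(ker P)` lies on the tangent cubic (above) and the near-point criterion p524988 applies. [folklore] -/
theorem hypersurface_null_polar_near [CharP κ 2] (c : (Fin n → ℕ) → κ) (hM : MultP 2 n κ c)
    (hI : Isol 2 n κ c) {lam : Fin n → κ} {i : Fin n} (hi : lam i ≠ 0)
    (hlam : Matrix.vecMul lam (polarMatrix (ser 2 n κ c)) = 0)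
    (hnull : ∀ v : Fin n → κ, Matrix.vecMul v (polarMatrix (ser 2 n κ c)) = 0 →
      ∑ s, lam s * degForm 2 (MvPowerSeries.pderiv s (ser 2 n κ c)) v = 0) :
    MultP 2 n κ (step 2 n κ i ((lam i)⁻¹ • lam) c) :=
  hypersurface_multP_step_of_vec c hM hI hi hlam (degForm_three_eq_zero_of_null_polar _ hlam hnull)

/-- [OURS · L1 W4.6 rung (ii) at `p = 2`, every dimension, EVERY field; NOT a statement of the manuscript]
Existence form: a NON-ZERO null polar `λ` of an isolated double state gives a chart and translation with a
double successor whose near vector is a multiple of `λ`. [folklore] -/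
theorem hypersurface_exists_double_successor_of_null_polar [CharP κ 2] (c : (Fin n → ℕ) → κ)
    (hM : MultP 2 n κ c) (hI : Isol 2 n κ c) {lam : Fin n → κ} (hlam0 : lam ≠ 0)
    (hlam : Matrix.vecMul lam (polarMatrix (ser 2 n κ c)) = 0)
    (hnull : ∀ v : Fin n → κ, Matrix.vecMul v (polarMatrix (ser 2 n κ c)) = 0 →
      ∑ s, lam s * degForm 2 (MvPowerSeries.pderiv s (ser 2 n κ c)) v = 0) :
    ∃ (i : Fin n) (τ : Fin n → κ), MultP 2 n κ (step 2 n κ i τ c) ∧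
      ∃ r : κ, Function.update τ i 1 = r • lam := by
  obtain ⟨i, hi⟩ : ∃ i, lam i ≠ 0 := by
    by_contra h
    push Not at h
    exact hlam0 (funext h)
  exact ⟨i, _, hypersurface_null_polar_near c hM hI hi hlam hnull, (lam i)⁻¹, update_inv_smul_eq hi⟩

/-! ## Corank two, `h₂ ≥ 2`: a near double point over every field -/

/-- [OURS · L1 W4.6 rung (ii) at `p = 2`, EVERY dimension `n`, EVERY field of characteristic `2`; NOT a
statement of the manuscript] **AT `h₂ ≥ 2` AN INFINITELY-NEAR DOUBLE POINT EXISTS OVER THE FIELD OF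
DEFINITION.** An isolated double state of `z² = a(u₁,…,uₙ)` with `e(c) = 2` and `h₂(c) ≥ 2` has a chart and
translation with a double successor: `h₂ ≥ 2` gives a non-zero null polar (p538084), which is near (above).
No perfectness (p538084) or algebraic closedness (p557052) is needed; at `h₂ = 1` the statement fails over
`𝔽₂` (an irreducible kernel cubic has no rational point). [folklore] -/
theorem hypersurface_exists_double_successor_of_two_le_milnorHilbertTwo [CharP κ 2] (c : (Fin n → ℕ) → κ)
    (hM : MultP 2 n κ c) (hI : Isol 2 n κ c) (he : milnorEmbDim 2 n κ c = 2)
    (hh : 2 ≤ milnorHilbertTwo 2 n κ c) :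
    ∃ (i : Fin n) (τ : Fin n → κ), MultP 2 n κ (step 2 n κ i τ c) := by
  obtain ⟨lam, hlam0, hlam, hnull⟩ := hypersurface_exists_null_polar_of_two_le_milnorHilbertTwo c hM he hh
  obtain ⟨i, τ, hM', -⟩ := hypersurface_exists_double_successor_of_null_polar c hM hI hlam0 hlam hnull
  exact ⟨i, τ, hM'⟩

/-! ## The free near point, if any, is the null polar -/

/-- [OURS · L1 W4.6 rung (ii) at `p = 2`, every dimension, EVERY field; NOT a statement of the manuscript]
**EVERY FREE NEAR VECTOR IS A MULTIPLE OF THE NULL POLAR.** Let `c` be a double state of `z² = a(u₁,…,uₙ)`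
(any field of characteristic `2`) with `e(c) = 2`, `λ₀ ≠ 0` a null polar, and `w` a kernel vector on the
tangent cubic at which some kernel polar is non-zero (a free near vector). Then `w ∈ κλ₀`: otherwise
`K = ⟨λ₀, w⟩` and every kernel polar at `w` would be `α·polar(λ₀, w) + β·polar(w, w) = 0 + β·a₃(w) = 0`.
[folklore] -/
theorem hypersurface_free_near_propto_null_polar [CharP κ 2] (c : (Fin n → ℕ) → κ) (hM : MultP 2 n κ c)
    (he : milnorEmbDim 2 n κ c = 2) {lam : Fin n → κ} (hlam0 : lam ≠ 0)
    (hlam : Matrix.vecMul lam (polarMatrix (ser 2 n κ c)) = 0)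
    (hnull : ∀ v : Fin n → κ, Matrix.vecMul v (polarMatrix (ser 2 n κ c)) = 0 →
      ∑ s, lam s * degForm 2 (MvPowerSeries.pderiv s (ser 2 n κ c)) v = 0)
    {w : Fin n → κ} (hw : Matrix.vecMul w (polarMatrix (ser 2 n κ c)) = 0)
    (hcw : degForm 3 (ser 2 n κ c) w = 0)
    (hfree : ∃ μ : Fin n → κ, Matrix.vecMul μ (polarMatrix (ser 2 n κ c)) = 0 ∧
      ∑ s, μ s * degForm 2 (MvPowerSeries.pderiv s (ser 2 n κ c)) w ≠ 0) :
    ∃ r : κ, w = r • lam := by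
  by_contra h
  push Not at h
  obtain ⟨μ, hμ, hne⟩ := hfree
  obtain ⟨α, β, hαβ⟩ := kernel_span_pair hM he hlam0 hlam hw h μ hμ
  rw [← hαβ, polar_add_smul, hnull w hw, ← degForm_three_eq_polar_self, hcw, mul_zero, mul_zero,
    add_zero] at hne
  exact hne rfl

/-- [OURS · L1 W4.6 rung (ii) at `p = 2`, every dimension, EVERY field; NOT a statement of the manuscript]
**EVERY CORANK-ZERO DOUBLE SUCCESSOR SITS AT THE NULL POLAR**: for a double state with `e(c) = 2` and a null
polar `λ₀ ≠ 0`, if the blow-up `(i, τ)` has a double successor of corank `0` (a free near point), then its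
near vector `(τ with τ_i = 1)` is a multiple of `λ₀`. [folklore] -/
theorem hypersurface_free_successor_at_null_polar [CharP κ 2] (c : (Fin n → ℕ) → κ) (hM : MultP 2 n κ c)
    (he : milnorEmbDim 2 n κ c = 2) {lam : Fin n → κ} (hlam0 : lam ≠ 0)
    (hlam : Matrix.vecMul lam (polarMatrix (ser 2 n κ c)) = 0)
    (hnull : ∀ v : Fin n → κ, Matrix.vecMul v (polarMatrix (ser 2 n κ c)) = 0 →
      ∑ s, lam s * degForm 2 (MvPowerSeries.pderiv s (ser 2 n κ c)) v = 0)
    (i : Fin n) (τ : Fin n → κ) (hM' : MultP 2 n κ (step 2 n κ i τ c))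
    (he' : milnorEmbDim 2 n κ (step 2 n κ i τ c) = 0) :
    ∃ r : κ, Function.update τ i 1 = r • lam := by
  obtain ⟨hk, hc⟩ := hypersurface_ker_and_cubic_of_double_successor c i τ hM hM'
  exact hypersurface_free_near_propto_null_polar c hM he hlam0 hlam hnull hk hc
    ((hypersurface_milnorEmbDim_step_eq_zero_iff c i τ hM he hM').mp he')

/-! ## `(2,2)`: the cube criterion without the satellite, and the dichotomy at `N` -/

/-- [OURS · L1 W4.6] If some kernel polar is non-zero at the null polar `λ` (`λ_i ≠ 0`) of an isolated double
state with `e(c) = 2`, the successor at `[λ]` is a double point of corank `0`. [folklore] -/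
theorem hypersurface_null_polar_free_step [CharP κ 2] (c : (Fin n → ℕ) → κ) (hM : MultP 2 n κ c)
    (hI : Isol 2 n κ c) (he : milnorEmbDim 2 n κ c = 2) {lam : Fin n → κ} {i : Fin n} (hi : lam i ≠ 0)
    (hlam : Matrix.vecMul lam (polarMatrix (ser 2 n κ c)) = 0)
    (hnull : ∀ v : Fin n → κ, Matrix.vecMul v (polarMatrix (ser 2 n κ c)) = 0 →
      ∑ s, lam s * degForm 2 (MvPowerSeries.pderiv s (ser 2 n κ c)) v = 0)
    {μ : Fin n → κ} (hμ : Matrix.vecMul μ (polarMatrix (ser 2 n κ c)) = 0)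
    (hne : ∑ s, μ s * degForm 2 (MvPowerSeries.pderiv s (ser 2 n κ c)) lam ≠ 0) :
    MultP 2 n κ (step 2 n κ i ((lam i)⁻¹ • lam) c) ∧
      milnorEmbDim 2 n κ (step 2 n κ i ((lam i)⁻¹ • lam) c) = 0 := by
  have hM' := hypersurface_null_polar_near c hM hI hi hlam hnull
  refine ⟨hM', (hypersurface_milnorEmbDim_step_eq_zero_iff c i _ hM he hM').mpr ⟨μ, hμ, ?_⟩⟩
  rw [update_inv_smul_eq hi, polar_smul_right]
  exact mul_ne_zero (pow_ne_zero 2 (inv_ne_zero hi)) hne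

/-- [OURS · L1 W4.6 rung (ii) at `p = 2`, every dimension, EVERY field; NOT a statement of the manuscript]
**THE CUBE CRITERION WITHOUT THE SATELLITE.** For an isolated double state of `z² = a(u₁,…,uₙ)` over any
field of characteristic `2` with `e(c) = 2` and a null polar `λ₀ ≠ 0` (one exists iff `h₂ ≥ 2`, p542945):
**a free infinitely-near double point (a double successor of corank `0`) EXISTS if and only if some kernel polar
is non-zero at `λ₀`** — iff `[λ₀]` is not a satellite, iff the kernel cubic is not the cube `ℓ₀³`. Unlike
p549448 this needs no satellite direction, which over an imperfect field may be irrational. [folklore] -/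
theorem hypersurface_exists_free_iff_null_polar_not_satellite [CharP κ 2] (c : (Fin n → ℕ) → κ)
    (hM : MultP 2 n κ c) (hI : Isol 2 n κ c) (he : milnorEmbDim 2 n κ c = 2) {lam : Fin n → κ}
    (hlam0 : lam ≠ 0) (hlam : Matrix.vecMul lam (polarMatrix (ser 2 n κ c)) = 0)
    (hnull : ∀ v : Fin n → κ, Matrix.vecMul v (polarMatrix (ser 2 n κ c)) = 0 →
      ∑ s, lam s * degForm 2 (MvPowerSeries.pderiv s (ser 2 n κ c)) v = 0) :
    (∃ (i : Fin n) (τ : Fin n → κ), MultP 2 n κ (step 2 n κ i τ c) ∧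
        milnorEmbDim 2 n κ (step 2 n κ i τ c) = 0) ↔
      ∃ μ : Fin n → κ, Matrix.vecMul μ (polarMatrix (ser 2 n κ c)) = 0 ∧
        ∑ s, μ s * degForm 2 (MvPowerSeries.pderiv s (ser 2 n κ c)) lam ≠ 0 := by
  constructor
  · rintro ⟨i, τ, hM', he'⟩
    obtain ⟨r, hr⟩ := hypersurface_free_successor_at_null_polar c hM he hlam0 hlam hnull i τ hM' he'
    obtain ⟨μ, hμ, hne⟩ := (hypersurface_milnorEmbDim_step_eq_zero_iff c i τ hM he hM').mp he'
    rw [hr, polar_smul_right] at hne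
    exact ⟨μ, hμ, fun h0 => hne (by rw [h0, mul_zero])⟩
  · rintro ⟨μ, hμ, hne⟩
    obtain ⟨i, hi⟩ : ∃ i, lam i ≠ 0 := by
      by_contra h
      push Not at h
      exact hlam0 (funext h)
    exact ⟨i, _, hypersurface_null_polar_free_step c hM hI he hi hlam hnull hμ hne⟩

/-- [OURS · L1 W4.6 rung (ii) at `p = 2`, every dimension, EVERY field; NOT a statement of the manuscript]
**THE DICHOTOMY AT THE NULL POLAR.** Let `c` be an isolated double state of `z² = a(u₁,…,uₙ)` over any field
of characteristic `2` with `(e, h₂) = (2, 2)` and `λ₀ ≠ 0` a null polar (`N = κλ₀`, p542945). EITHER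
(a) `[λ₀]` is FREE: some kernel polar is non-zero at `λ₀`; some chart at `[λ₀]` has a double successor of
corank `0` — isolated, `μ = 1`, no double point after it — and every double successor whose near vector is NOT
a multiple of `λ₀` is a SATELLITE (corank `2`, isolated, `μ` drops; at most one, p536239); OR (b) `[λ₀]` is the
SATELLITE (all kernel polars vanish at `λ₀`; the kernel cubic is a cube): EVERY double successor has near
vector a multiple of `λ₀` and corank `2` — exactly one infinitely-near double point. [folklore] -/
theorem hypersurface_null_polar_dichotomy [CharP κ 2] (c : (Fin n → ℕ) → κ) (hM : MultP 2 n κ c)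
    (hI : Isol 2 n κ c) (he : milnorEmbDim 2 n κ c = 2) (hh : milnorHilbertTwo 2 n κ c = 2)
    {lam : Fin n → κ} (hlam0 : lam ≠ 0) (hlam : Matrix.vecMul lam (polarMatrix (ser 2 n κ c)) = 0)
    (hnull : ∀ v : Fin n → κ, Matrix.vecMul v (polarMatrix (ser 2 n κ c)) = 0 →
      ∑ s, lam s * degForm 2 (MvPowerSeries.pderiv s (ser 2 n κ c)) v = 0) :
    ((∃ μ : Fin n → κ, Matrix.vecMul μ (polarMatrix (ser 2 n κ c)) = 0 ∧
          ∑ s, μ s * degForm 2 (MvPowerSeries.pderiv s (ser 2 n κ c)) lam ≠ 0) ∧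
        (∃ (i : Fin n) (τ : Fin n → κ), MultP 2 n κ (step 2 n κ i τ c) ∧
          milnorEmbDim 2 n κ (step 2 n κ i τ c) = 0 ∧ Isol 2 n κ (step 2 n κ i τ c) ∧
          mu 2 n κ (step 2 n κ i τ c) = 1 ∧
          (∀ (i' : Fin n) (τ' : Fin n → κ), ¬ MultP 2 n κ (step 2 n κ i' τ' (step 2 n κ i τ c))) ∧
          ∃ r : κ, Function.update τ i 1 = r • lam) ∧
        ∀ (i : Fin n) (τ : Fin n → κ), MultP 2 n κ (step 2 n κ i τ c) →
          (∀ r : κ, Function.update τ i 1 ≠ r • lam) →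
            milnorEmbDim 2 n κ (step 2 n κ i τ c) = 2 ∧ Isol 2 n κ (step 2 n κ i τ c) ∧
              mu 2 n κ (step 2 n κ i τ c) < mu 2 n κ c) ∨
      ((∀ μ : Fin n → κ, Matrix.vecMul μ (polarMatrix (ser 2 n κ c)) = 0 →
          ∑ s, μ s * degForm 2 (MvPowerSeries.pderiv s (ser 2 n κ c)) lam = 0) ∧
        ∀ (i : Fin n) (τ : Fin n → κ), MultP 2 n κ (step 2 n κ i τ c) →
          (∃ r : κ, Function.update τ i 1 = r • lam) ∧ milnorEmbDim 2 n κ (step 2 n κ i τ c) = 2) := by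
  by_cases hfree : ∃ μ : Fin n → κ, Matrix.vecMul μ (polarMatrix (ser 2 n κ c)) = 0 ∧
      ∑ s, μ s * degForm 2 (MvPowerSeries.pderiv s (ser 2 n κ c)) lam ≠ 0
  · refine Or.inl ⟨hfree, ?_, fun i τ hM' hnot => ?_⟩
    · obtain ⟨μ, hμ, hne⟩ := hfree
      obtain ⟨i, hi⟩ : ∃ i, lam i ≠ 0 := by
        by_contra h
        push Not at h
        exact hlam0 (funext h)
      obtain ⟨hM', he'⟩ := hypersurface_null_polar_free_step c hM hI he hi hlam hnull hμ hne
      obtain ⟨v, hv, hvne⟩ := (hypersurface_milnorEmbDim_step_eq_zero_iff c i _ hM he hM').mp he'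
      obtain ⟨hI', hμ', hno⟩ := hypersurface_simple_tangent_resolved c i _ hM he hM' hv hvne
      exact ⟨i, _, hM', he', hI', hμ', hno, (lam i)⁻¹, update_inv_smul_eq hi⟩
    · rcases hypersurface_successor_dichotomy_of_milnorHilbertTwo_le_two c hM hI he (by omega) i τ hM' with
        ⟨he2, hI2, hμ2⟩ | ⟨he0, -⟩
      · exact ⟨he2, hI2, hμ2⟩
      · obtain ⟨r, hr⟩ := hypersurface_free_successor_at_null_polar c hM he hlam0 hlam hnull i τ hM' he0
        exact absurd hr (hnot r)
  · push Not at hfree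
    exact Or.inr ⟨hfree, fun i τ hM' =>
      hypersurface_only_satellite_of_satellite_null c hM he (by omega) hlam0 hlam hfree hnull i τ hM'⟩

/-! ## The `(2,2)` census over every field -/

/-- [OURS · L1 W4.6 rung (ii) at `p = 2`, EVERY dimension `n`, EVERY field of characteristic `2`; NOT a
statement of the manuscript] **THE MULTIPLE-TANGENT CENSUS OVER THE FIELD OF DEFINITION.** An isolated double
state of `z² = a(u₁,…,uₙ)` with `(e, h₂) = (2, 2)` has a non-zero null polar `λ₀` such that: (1) `[λ₀]` IS an
infinitely-near double point (some chart/translation with near vector in `κλ₀` has a double successor);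
(2) every double successor is EITHER free — corank `0`, isolated, `μ = 1`, nothing after it — with near vector
IN `κλ₀`, OR a satellite — corank `2`, isolated, `μ` drops, all kernel polars vanish at its near vector (at
most one satellite direction, p536239). So over every field the near double points are `[λ₀]` and at most
the satellite: AT LEAST ONE and (p544683) at most two. Over a perfect field the satellite is rational
(p538084) and p549448's exact count follows; over `κ = 𝔽₂(t)` the isolated state `u₀u₁ + x³ + t·xy² + y⁵`
has exactly one near point, the free point `[λ₀]`, its satellite `[√t : 1]` being irrational (proved in
`…HypersurfacesCharTwoFourfoldImperfect.lean`). [folklore] -/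
theorem hypersurface_near_census_anyField_of_milnorHilbertTwo_eq_two [CharP κ 2] (c : (Fin n → ℕ) → κ)
    (hM : MultP 2 n κ c) (hI : Isol 2 n κ c) (he : milnorEmbDim 2 n κ c = 2)
    (hh : milnorHilbertTwo 2 n κ c = 2) :
    ∃ lam : Fin n → κ, lam ≠ 0 ∧ Matrix.vecMul lam (polarMatrix (ser 2 n κ c)) = 0 ∧
      (∀ v : Fin n → κ, Matrix.vecMul v (polarMatrix (ser 2 n κ c)) = 0 →
        ∑ s, lam s * degForm 2 (MvPowerSeries.pderiv s (ser 2 n κ c)) v = 0) ∧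
      (∃ (i : Fin n) (τ : Fin n → κ), MultP 2 n κ (step 2 n κ i τ c) ∧
        ∃ r : κ, Function.update τ i 1 = r • lam) ∧
      ∀ (i : Fin n) (τ : Fin n → κ), MultP 2 n κ (step 2 n κ i τ c) →
        (milnorEmbDim 2 n κ (step 2 n κ i τ c) = 0 ∧ Isol 2 n κ (step 2 n κ i τ c) ∧
            mu 2 n κ (step 2 n κ i τ c) = 1 ∧
            (∀ (i' : Fin n) (τ' : Fin n → κ), ¬ MultP 2 n κ (step 2 n κ i' τ' (step 2 n κ i τ c))) ∧
            ∃ r : κ, Function.update τ i 1 = r • lam) ∨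
          (milnorEmbDim 2 n κ (step 2 n κ i τ c) = 2 ∧ Isol 2 n κ (step 2 n κ i τ c) ∧
            mu 2 n κ (step 2 n κ i τ c) < mu 2 n κ c ∧
            ∀ μ : Fin n → κ, Matrix.vecMul μ (polarMatrix (ser 2 n κ c)) = 0 →
              ∑ s, μ s * degForm 2 (MvPowerSeries.pderiv s (ser 2 n κ c)) (Function.update τ i 1) = 0) := by
  obtain ⟨lam, hlam0, hlam, hnull⟩ :=
    hypersurface_exists_null_polar_of_two_le_milnorHilbertTwo c hM he (by omega)
  refine ⟨lam, hlam0, hlam, hnull, hypersurface_exists_double_successor_of_null_polar c hM hI hlam0 hlam hnull,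
    fun i τ hM' => ?_⟩
  rcases hypersurface_successor_dichotomy_of_milnorHilbertTwo_le_two c hM hI he (by omega) i τ hM' with
    ⟨he2, hI2, hμ2⟩ | ⟨he0, hI0, hμ0, hno⟩
  · exact Or.inr ⟨he2, hI2, hμ2, (hypersurface_milnorEmbDim_step_eq_two_iff c i τ hM he hM').mp he2⟩
  · exact Or.inl ⟨he0, hI0, hμ0, hno,
      hypersurface_free_successor_at_null_polar c hM he hlam0 hlam hnull i τ hM' he0⟩

/-- [OURS · L1 W4.6 rung (ii) at `p = 2`, EVERY dimension `n`, EVERY field of characteristic `2`; NOT a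
statement of the manuscript] **AT `h₂ ≥ 2` THE NEAR DOUBLE POINTS ARE NEVER EMPTY; at `h₂ = 3` they fill the
kernel line.** Summary over the field of definition for an isolated double state with `e(c) = 2`: if
`h₂(c) ≥ 2` some double successor exists (this file); if `h₂(c) = 3` every kernel direction is a
(non-isolated) double successor (p530584); if `h₂(c) = 2` the census above. [folklore] -/
theorem hypersurface_near_nonempty_summary [CharP κ 2] (c : (Fin n → ℕ) → κ) (hM : MultP 2 n κ c)
    (hI : Isol 2 n κ c) (he : milnorEmbDim 2 n κ c = 2) (hh : 2 ≤ milnorHilbertTwo 2 n κ c) :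
    (∃ (i : Fin n) (τ : Fin n → κ), MultP 2 n κ (step 2 n κ i τ c)) ∧
      (milnorHilbertTwo 2 n κ c = 3 → ∀ (w : Fin n → κ) (i : Fin n),
        Matrix.vecMul w (polarMatrix (ser 2 n κ c)) = 0 → w i ≠ 0 →
          MultP 2 n κ (step 2 n κ i ((w i)⁻¹ • w) c) ∧ ¬ Isol 2 n κ (step 2 n κ i ((w i)⁻¹ • w) c)) :=
  ⟨hypersurface_exists_double_successor_of_two_le_milnorHilbertTwo c hM hI he hh,
    fun h3 _ _ hw hwi => hypersurface_whole_kernel_near_of_milnorHilbertTwo_eq_three c hM hI he h3 hw hwi⟩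

end CampaignW46.HypersurfacesCharTwo

end Summit.ResolutionOfSingularities.ResolutionOfSingularities.Theorems

end
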